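import Summits.ValiantsHypothesis.ValiantsHypothesis.Theses.CirculantFourier
import Literature.Computability.AlgebraicComplexity.ValiantClassesProofs
import Literature.Computability.AlgebraicComplexity.ValiantConjectureEquivProofs

/-!
# Route `CirculantFourier` — the hub (item stmt-ValiantsHypothesis-6311, `CircHub`)

`CircHub := ¬ IsPComputable q → ValiantsHypothesis`, where
`q_n := per (circulant (X_0, …, X_{n-1})) = per (X_{i-j})_{i,j} ∈ ℂ[X_0, …, X_{n-1}]` is the
circulant permanent family (the permanent restricted to the regular representation of `ℤ/n`).

Proof (pure bookkeeping; Valiant 1979, Bürgisser 2000, §2.1 with Rem. 2.7 and Rem. 2.11):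
`q_n` is the projection of the generic permanent `PER_n = perPoly (Fin n) k` under the variable
substitution `X_{ij} ↦ X_{i-j}` (indices mod `n`), with `t = id`, so
`IsPComputable PER ⇒ IsPComputable q` (`IsPComputable.of_isPProjection_holds`, projections are
free); contrapose and use `perNotPComputableComplex_iff_holds : ¬ IsPComputable PER ↔ VP ℂ ≠ VNP ℂ`,
whose right-hand side is `ValiantsHypothesis` by definition.
-/

-- `Summit.ValiantsHypothesis.ValiantsHypothesis.…` is the tree's mandated single-conjunct layout
-- (Sub = Summit), so the duplicated namespace component is intended.
set_option linter.dupNamespace false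

noncomputable section

namespace Summit.ValiantsHypothesis.ValiantsHypothesis.Theorems.CirculantFourier

open MvPolynomial
open Literature.Computability.AlgebraicComplexity
open Summit.ValiantsHypothesis.ValiantsHypothesis.Theses.CirculantFourier

universe u

/-- Substituting the variable `X_{i-j}` for `X_{ij}` in the generic permanent `PER_n` gives the
circulant permanent `per (X_{i-j})_{i,j}` (over any commutative semiring). [folklore] -/
theorem aeval_circulantSubst_perPoly (k : Type u) [CommSemiring k] (n : ℕ) :
    aeval (fun ij : Fin n × Fin n => (X (ij.1 - ij.2) : MvPolynomial (Fin n) k))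
        (perPoly (Fin n) k) =
      (Matrix.circulant fun i : Fin n => (X i : MvPolynomial (Fin n) k)).permanent := by
  simp [perPoly, Matrix.permanent, map_sum, map_prod, Matrix.mvPolynomialX, Matrix.circulant]

/-- The circulant permanent `per (X_{i-j})_{i,j}` is a (Valiant) projection of the generic
permanent `PER_n`: substitute the variable `X_{i-j}` for `X_{ij}` (Valiant 1979; Bürgisser 2000,
Def. 2.6(1)). [folklore] -/
theorem isProjection_circulantPermanent_perPoly (k : Type u) [CommSemiring k] (n : ℕ) :
    IsProjection (Matrix.circulant fun i : Fin n => (X i : MvPolynomial (Fin n) k)).permanent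
      (perPoly (Fin n) k) :=
  ⟨fun ij => X (ij.1 - ij.2), fun ij => Or.inl ⟨ij.1 - ij.2, rfl⟩,
    (aeval_circulantSubst_perPoly k n).symm⟩

/-- The circulant permanent family is a p-projection (with `t = id`) of the permanent family
(Bürgisser 2000, Def. 2.6(2)). [folklore] -/
theorem isPProjection_circulantPermanent_perPoly (k : Type u) [CommSemiring k] :
    IsPProjection
      (fun n => (Matrix.circulant fun i : Fin n => (X i : MvPolynomial (Fin n) k)).permanent)
      (fun n => perPoly (Fin n) k) :=
  ⟨id, IsPBounded.id, fun n => isProjection_circulantPermanent_perPoly k n⟩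

/-- If the permanent family is p-computable then so is the circulant permanent family — a
p-projection of a p-computable family is p-computable (Bürgisser 2000, Rem. 2.7;
`IsPComputable.of_isPProjection_holds`). [folklore] -/
theorem isPComputable_circulantPermanent_of_perPoly (k : Type u) [CommSemiring k]
    (h : IsPComputable (fun n => perPoly (Fin n) k)) :
    IsPComputable
      (fun n => (Matrix.circulant fun i : Fin n => (X i : MvPolynomial (Fin n) k)).permanent) :=
  IsPComputable.of_isPProjection_holds (isPProjection_circulantPermanent_perPoly k) h

/-- **Settles item stmt-ValiantsHypothesis-6311** (`CircHub`, route `CirculantFourier`): if the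
circulant permanent family `q_n = per (circulant X)` over `ℂ` is not p-computable, then
`VP_ℂ ≠ VNP_ℂ` (`ValiantsHypothesis`). Indeed `q` is a p-projection of `PER`, so `¬ IsPComputable q`
gives `¬ IsPComputable PER`, which is equivalent to `VP ℂ ≠ VNP ℂ`
(`perNotPComputableComplex_iff_holds`; Bürgisser 2000, Rem. 2.11). [folklore] -/
theorem circHub_proof : CircHub := by
  unfold CircHub
  intro hq
  show VP ℂ ≠ VNP ℂ
  rw [← perNotPComputableComplex_iff_holds]
  exact fun hper => hq (isPComputable_circulantPermanent_of_perPoly ℂ hper)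

end Summit.ValiantsHypothesis.ValiantsHypothesis.Theorems.CirculantFourier

end
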